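import Summits.HodgeConjecture.HodgeConjecture.Theorems.F0P2aCohIsotypicLineBootstrap
import Summits.HodgeConjecture.HodgeConjecture.Theorems.F0P2aArchOrthHolOfCuts
import Summits.HodgeConjecture.HodgeConjecture.Theorems.F0P2aStubArchOrthAntiholOfHol
import Summits.HodgeConjecture.HodgeConjecture.Theorems.F0P2aStubDensity
import Summits.HodgeConjecture.HodgeConjecture.Theorems.F0P2aCohFormsContinuous
import Summits.HodgeConjecture.HodgeConjecture.Theorems.F0P2aStubAdmissibleOfCohValued
import HarnessLib

/-!
# F0-P2a · line 2 CLOSED BY NAME — II: the isotypic-line letters (E) ★ `CotangentForms.cohIsotypicLine_hol / _antihol` PROVED (lead p01)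

Cell hodgecm-mathlib, FLOOR 0; crux `H413` = `stmt-HodgeConjecture-24833`; line `Cruxes/H413/Lines/F0_P2aCohIsotypicLine.lean`, ed. 4 (all five
stubs ★).  THEOREMS ONLY; `--supports stmt-HodgeConjecture-24833 --as helper`.  §4–§6 of the line ported to an importable module over the ★ stub
closers, so that the engine (F0P3's `stubS3_of_letters` / `stubS4_of_letters` / `H413_of_letters`) can IMPORT the letters instead of taking them as
binders: `orthVanish_hol` / `orthVanish_antihol` (from ★ S2⁺ `F0P2aArchOrthHol.stub_archOrth_hol_holds`, ★ S2⁻ `F0P2aArchOrthAntihol.archOrth_antihol_of_hol`,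
★ S2β `F0P2aStubDensity.densityType_of_continuous` ∘ `F0P2aCohFormsContinuous.continuous_of_mem_cohForms_frame`), the admissible heads
`cohIsotypicLineAdm_hol_holds` / `cohIsotypicLineAdm_antihol_holds` (= the fold binders `hEhol` / `hEantihol` of `F0P3StubS3Fold.stubS3_of_letters` /
`F0P3StubS4Fold.stubS4_of_letters`, TOKEN FOR TOKEN), and the FILED LETTERS BY NAME `cohIsotypicLine_hol_holds : CotangentForms.cohIsotypicLine_hol`,
`cohIsotypicLine_antihol_holds : CotangentForms.cohIsotypicLine_antihol` (with ★ S3 `F0P2aStubAdmissibleOfCohValued.stubS3_holds`).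
HC_CM is proved only modulo the printed citations until rung 0 closes.

## References
* [Liu2021] Y. Liu, arXiv:2106.08732, App. D, Lem. D.2 (2).  [BorelWallach2000] VI 4.11, VII 2.10/3.2.  [HarishChandraTAMS1953] Cor. to Thm 2.
* [BorelJacquet1979] Corvallis §4.2, §4.6.  [Rogawski1990] Prop. 15.2.1 (b).
-/

set_option autoImplicit false
set_option linter.dupNamespace false

noncomputable section

open MeasureTheory NumberField
open scoped InnerProductSpace ENNReal ComplexOrder Matrix

namespace Summit.HodgeConjecture.HodgeConjecture.Cruxes.H413.F0P2aCohIsotypicLineHolds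

open Literature.NumberTheory.Automorphic Literature.NumberTheory.Automorphic.UnitaryGroup
open Literature.NumberTheory.Automorphic.UnitaryGroup.CotangentForms (toQuotFun cmArchSection cmCompactFactor)
open Summit.HodgeConjecture.HodgeConjecture.Cruxes.H413.SpectrumJunction

/-! ## §2 The CM factor: `OrthVanish` for `hol` and `antihol` from S2⁺ / S2⁻ and S2β -/

section CM

variable (L : Type) [Field L] [NumberField L] [IsCMField L] (ι : L →+* ℂ) (H : Matrix (Fin 3) (Fin 3) L) (T : GL (Fin 3) ℂ)
  (hT : (T : Matrix (Fin 3) (Fin 3) ℂ)ᴴ * H.map ι * (T : Matrix (Fin 3) (Fin 3) ℂ) = Literature.Geometry.ComplexHyperbolic.BallModel.J)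

/-- `antihol ≤ coh` (`cohForms = hol ⊔ hol.map conjFun`). [cite: BorelWallach2000, VII 2.10] -/
theorem antihol_le_coh :
    ((CotangentForms.holCotForms (↥(maximalRealSubfield L)) L (IsCMField.complexConj L) 3 H (cmArchSection L ι H T hT)
        (cmCompactFactor L ι H T hT)).map (CotangentForms.conjFun (↥(maximalRealSubfield L)) L (IsCMField.complexConj L) 3 H)) ≤
      (CotangentForms.cohForms (↥(maximalRealSubfield L)) L (IsCMField.complexConj L) 3 H (cmArchSection L ι H T hT)
        (cmCompactFactor L ι H T hT)) := fun Φ hΦ => by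
  unfold CotangentForms.cohForms
  exact Submodule.mem_sup_right hΦ

/-- Antiholomorphic cotangent forms are left-`U(H)(L⁺)`-invariant. [cite: BorelJacquet1979, §4.2] -/
theorem leftInvariant_of_mem_antihol {Φ : (adelicGroupData (↥(maximalRealSubfield L)) L (IsCMField.complexConj L) 3 H).Adelic → (Fin 2 → ℂ)} (hΦ : Φ ∈ ((CotangentForms.holCotForms (↥(maximalRealSubfield L)) L (IsCMField.complexConj L) 3 H (cmArchSection L ι H T hT) (cmCompactFactor L ι H T hT)).map (CotangentForms.conjFun (↥(maximalRealSubfield L)) L (IsCMField.complexConj L) 3 H))) :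
    ∀ γ ∈ (adelicGroupData (↥(maximalRealSubfield L)) L (IsCMField.complexConj L) 3 H).quotientSubgroup, ∀ x, Φ (γ * x) = Φ x :=
  leftInvariant_of_mem_cohForms (antihol_le_coh L ι H T hT hΦ)

variable {L ι H T hT}

/-- `OrthVanish (hol) P` from ★ S2⁺ (`F0P2aArchOrthHol.stub_archOrth_hol_holds`) and ★ S2β (`F0P2aStubDensity` ∘ `F0P2aCohFormsContinuous`). [cite: BorelWallach2000, VII 3.2] [cite: HarishChandraTAMS1953, Cor. to Thm 2] -/
theorem orthVanish_hol
    (hdef : ∀ τ' : L →+* ℂ, InfinitePlace.mk τ' ≠ InfinitePlace.mk ι → (H.map τ').PosDef)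
    (h2 : 2 ≤ Module.finrank ℚ ↥(maximalRealSubfield L))
    (μ : Measure (adelicGroupData (↥(maximalRealSubfield L)) L (IsCMField.complexConj L) 3 H).automorphicQuotient) [(adelicGroupData (↥(maximalRealSubfield L)) L (IsCMField.complexConj L) 3 H).IsAutomorphicMeasure μ] (P : DiscreteAutomorphicRep (adelicGroupData (↥(maximalRealSubfield L)) L (IsCMField.complexConj L) 3 H) μ) :
    ∀ N' : Submodule ℂ ((adelicGroupData (↥(maximalRealSubfield L)) L (IsCMField.complexConj L) 3 H).Adelic → (Fin 2 → ℂ)), N' ≤ (CotangentForms.holCotForms (↥(maximalRealSubfield L)) L (IsCMField.complexConj L) 3 H (cmArchSection L ι H T hT) (cmCompactFactor L ι H T hT)) →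
      (∀ Φ ∈ N', P.ContainsForm Φ) →
      (∀ (g : finAdelic (↥(maximalRealSubfield L)) L (IsCMField.complexConj L) 3 H), ∀ Φ ∈ N',
        CotangentForms.rightRep (↥(maximalRealSubfield L)) L (IsCMField.complexConj L) 3 H g Φ ∈ N') → N' ≠ ⊥ →
      ∀ Φ₃ ∈ (CotangentForms.holCotForms (↥(maximalRealSubfield L)) L (IsCMField.complexConj L) 3 H (cmArchSection L ι H T hT) (cmCompactFactor L ι H T hT)), P.ContainsForm Φ₃ →
      (∀ Φ ∈ N', ∀ (hΦ : ∀ j : Fin 2, MemLp (toQuotFun (adelicGroupData (↥(maximalRealSubfield L)) L (IsCMField.complexConj L) 3 H) fun x => Φ x j) 2 μ)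
          (h₃ : ∀ j : Fin 2, MemLp (toQuotFun (adelicGroupData (↥(maximalRealSubfield L)) L (IsCMField.complexConj L) 3 H) fun x => Φ₃ x j) 2 μ),
        ∑ j : Fin 2, ⟪(hΦ j).toLp (toQuotFun (adelicGroupData (↥(maximalRealSubfield L)) L (IsCMField.complexConj L) 3 H) fun x => Φ x j),
          (h₃ j).toLp (toQuotFun (adelicGroupData (↥(maximalRealSubfield L)) L (IsCMField.complexConj L) 3 H) fun x => Φ₃ x j)⟫_ℂ = 0) →
      Φ₃ = 0 := by
  intro N' hNA hNP hNst hN0 Φ₃ hΦ₃ hP₃ horth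
  exact (F0P2aStubDensity.densityType_of_continuous F0P2aCohFormsContinuous.continuous_of_mem_cohForms_frame) L ι H T hT hdef h2 μ P N' (fun Φ hΦ => CotangentForms.holCotForms_le_cohForms (hNA hΦ)) hNP hNst hN0 Φ₃
    (CotangentForms.holCotForms_le_cohForms hΦ₃) hP₃
    (fun Φ hΦ hΦm h₃m u j j' => F0P2aArchOrthHol.stub_archOrth_hol_holds L ι H T hT hdef h2 μ Φ Φ₃ (hNA hΦ) hΦ₃ hΦm h₃m (horth Φ hΦ hΦm h₃m) u j j')

/-- `OrthVanish (antihol) P` from ★ S2⁻ (`F0P2aArchOrthAntihol.archOrth_antihol_of_hol` of ★ S2⁺) and ★ S2β. [cite: BorelWallach2000, VII 2.10, 3.2] [cite: HarishChandraTAMS1953, Cor. to Thm 2] -/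
theorem orthVanish_antihol
    (hdef : ∀ τ' : L →+* ℂ, InfinitePlace.mk τ' ≠ InfinitePlace.mk ι → (H.map τ').PosDef)
    (h2 : 2 ≤ Module.finrank ℚ ↥(maximalRealSubfield L))
    (μ : Measure (adelicGroupData (↥(maximalRealSubfield L)) L (IsCMField.complexConj L) 3 H).automorphicQuotient) [(adelicGroupData (↥(maximalRealSubfield L)) L (IsCMField.complexConj L) 3 H).IsAutomorphicMeasure μ] (P : DiscreteAutomorphicRep (adelicGroupData (↥(maximalRealSubfield L)) L (IsCMField.complexConj L) 3 H) μ) :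
    ∀ N' : Submodule ℂ ((adelicGroupData (↥(maximalRealSubfield L)) L (IsCMField.complexConj L) 3 H).Adelic → (Fin 2 → ℂ)), N' ≤ ((CotangentForms.holCotForms (↥(maximalRealSubfield L)) L (IsCMField.complexConj L) 3 H (cmArchSection L ι H T hT) (cmCompactFactor L ι H T hT)).map (CotangentForms.conjFun (↥(maximalRealSubfield L)) L (IsCMField.complexConj L) 3 H)) →
      (∀ Φ ∈ N', P.ContainsForm Φ) →
      (∀ (g : finAdelic (↥(maximalRealSubfield L)) L (IsCMField.complexConj L) 3 H), ∀ Φ ∈ N',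
        CotangentForms.rightRep (↥(maximalRealSubfield L)) L (IsCMField.complexConj L) 3 H g Φ ∈ N') → N' ≠ ⊥ →
      ∀ Φ₃ ∈ ((CotangentForms.holCotForms (↥(maximalRealSubfield L)) L (IsCMField.complexConj L) 3 H (cmArchSection L ι H T hT) (cmCompactFactor L ι H T hT)).map (CotangentForms.conjFun (↥(maximalRealSubfield L)) L (IsCMField.complexConj L) 3 H)), P.ContainsForm Φ₃ →
      (∀ Φ ∈ N', ∀ (hΦ : ∀ j : Fin 2, MemLp (toQuotFun (adelicGroupData (↥(maximalRealSubfield L)) L (IsCMField.complexConj L) 3 H) fun x => Φ x j) 2 μ)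
          (h₃ : ∀ j : Fin 2, MemLp (toQuotFun (adelicGroupData (↥(maximalRealSubfield L)) L (IsCMField.complexConj L) 3 H) fun x => Φ₃ x j) 2 μ),
        ∑ j : Fin 2, ⟪(hΦ j).toLp (toQuotFun (adelicGroupData (↥(maximalRealSubfield L)) L (IsCMField.complexConj L) 3 H) fun x => Φ x j),
          (h₃ j).toLp (toQuotFun (adelicGroupData (↥(maximalRealSubfield L)) L (IsCMField.complexConj L) 3 H) fun x => Φ₃ x j)⟫_ℂ = 0) →
      Φ₃ = 0 := by
  intro N' hNA hNP hNst hN0 Φ₃ hΦ₃ hP₃ horth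
  exact (F0P2aStubDensity.densityType_of_continuous F0P2aCohFormsContinuous.continuous_of_mem_cohForms_frame) L ι H T hT hdef h2 μ P N' (fun Φ hΦ => antihol_le_coh L ι H T hT (hNA hΦ)) hNP hNst hN0 Φ₃
    (antihol_le_coh L ι H T hT hΦ₃) hP₃
    (fun Φ hΦ hΦm h₃m u j j' => (F0P2aArchOrthAntihol.archOrth_antihol_of_hol F0P2aArchOrthHol.stub_archOrth_hol_holds) L ι H T hT hdef h2 μ Φ Φ₃ (hNA hΦ) hΦ₃ hΦm h₃m (horth Φ hΦ hΦm h₃m) u j j')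

end CM

/-! ## §3 THE (E) LETTERS AND THE ADMISSIBLE HEADS, CLOSED BY NAME (fold binders `hEhol` / `hEantihol` verbatim; filed letters by name) -/

/-- **HEAD (E-hol, admissible binder) = F0P3-p03's `hEhol` TOKEN FOR TOKEN.** [cite: Liu2021, Lem. D.2 (2)] [cite: BorelWallach2000, VI 4.11; VII 3.2] -/
theorem cohIsotypicLineAdm_hol_holds :
    ∀ (L : Type) [Field L] [NumberField L] [IsCMField L] (ι : L →+* ℂ) (H : Matrix (Fin 3) (Fin 3) L) (T : GL (Fin 3) ℂ)
      (hT : (T : Matrix (Fin 3) (Fin 3) ℂ)ᴴ * H.map ι * (T : Matrix (Fin 3) (Fin 3) ℂ) = Literature.Geometry.ComplexHyperbolic.BallModel.J),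
      (∀ τ' : L →+* ℂ, InfinitePlace.mk τ' ≠ InfinitePlace.mk ι → (H.map τ').PosDef) →
      2 ≤ Module.finrank ℚ ↥(maximalRealSubfield L) →
      ∀ (μ : Measure (adelicGroupData (↥(maximalRealSubfield L)) L (IsCMField.complexConj L) 3 H).automorphicQuotient)
      [(adelicGroupData (↥(maximalRealSubfield L)) L (IsCMField.complexConj L) 3 H).IsAutomorphicMeasure μ]
      (W : Type) [AddCommGroup W] [Module ℂ W]
      (σ : Representation ℂ (finAdelic (↥(maximalRealSubfield L)) L (IsCMField.complexConj L) 3 H) W),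
      σ.IsIrreducible → σ.IsSmooth → σ.IsAdmissible →
      ∀ P : DiscreteAutomorphicRep (adelicGroupData (↥(maximalRealSubfield L)) L (IsCMField.complexConj L) 3 H) μ,
      ∃ ψ₀ : W →ₗ[ℂ] ((adelicGroupData (↥(maximalRealSubfield L)) L (IsCMField.complexConj L) 3 H).Adelic → (Fin 2 → ℂ)),
      ∀ ψ : W →ₗ[ℂ] ((adelicGroupData (↥(maximalRealSubfield L)) L (IsCMField.complexConj L) 3 H).Adelic → (Fin 2 → ℂ)),
      (∀ (g : finAdelic (↥(maximalRealSubfield L)) L (IsCMField.complexConj L) 3 H) (w : W),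
      ψ (σ g w) = CotangentForms.rightRep (↥(maximalRealSubfield L)) L (IsCMField.complexConj L) 3 H g (ψ w)) →
      (∀ w : W, ψ w ∈ CotangentForms.holCotForms (↥(maximalRealSubfield L)) L (IsCMField.complexConj L) 3 H (cmArchSection L ι H T hT)
      (cmCompactFactor L ι H T hT) ∧ P.ContainsForm (ψ w)) →
      ∃ r : ℂ, ψ = r • ψ₀ := by
  intro L _ _ _ ι H T hT hdef h2 μ _ W _ _ σ hirr _ hadm P
  by_cases hex : ∃ ψ₁ : W →ₗ[ℂ] ((adelicGroupData (↥(maximalRealSubfield L)) L (IsCMField.complexConj L) 3 H).Adelic → (Fin 2 → ℂ)),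
      (∀ (g : finAdelic (↥(maximalRealSubfield L)) L (IsCMField.complexConj L) 3 H) (w : W), ψ₁ (σ g w) = CotangentForms.rightRep (↥(maximalRealSubfield L)) L (IsCMField.complexConj L) 3 H g (ψ₁ w)) ∧ (∀ w : W, ψ₁ w ∈ (CotangentForms.holCotForms (↥(maximalRealSubfield L)) L (IsCMField.complexConj L) 3 H (cmArchSection L ι H T hT) (cmCompactFactor L ι H T hT)) ∧ P.ContainsForm (ψ₁ w)) ∧ ψ₁ ≠ 0
  · obtain ⟨ψ₁, hE₁, hV₁, hne⟩ := hex
    exact ⟨ψ₁, fun ψ hE hV => exists_eq_smul_of_orthVanish P ((CotangentForms.holCotForms (↥(maximalRealSubfield L)) L (IsCMField.complexConj L) 3 H (cmArchSection L ι H T hT) (cmCompactFactor L ι H T hT))) (fun Φ hΦ => leftInvariant_of_mem_holCotForms hΦ)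
      (orthVanish_hol hdef h2 μ P) σ hirr hadm ψ₁ ψ hE₁ hV₁ hne hE hV⟩
  · refine ⟨0, fun ψ hE hV => ⟨0, ?_⟩⟩
    push Not at hex
    rw [hex ψ hE hV, smul_zero]

/-- **HEAD (E-antihol, admissible binder) = F0P3-p03's `hEantihol` TOKEN FOR TOKEN.** [cite: Liu2021, Lem. D.2 (2)] [cite: BorelWallach2000, VII 2.10, 3.2] -/
theorem cohIsotypicLineAdm_antihol_holds :
    ∀ (L : Type) [Field L] [NumberField L] [IsCMField L] (ι : L →+* ℂ) (H : Matrix (Fin 3) (Fin 3) L) (T : GL (Fin 3) ℂ)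
      (hT : (T : Matrix (Fin 3) (Fin 3) ℂ)ᴴ * H.map ι * (T : Matrix (Fin 3) (Fin 3) ℂ) = Literature.Geometry.ComplexHyperbolic.BallModel.J),
      (∀ τ' : L →+* ℂ, InfinitePlace.mk τ' ≠ InfinitePlace.mk ι → (H.map τ').PosDef) →
      2 ≤ Module.finrank ℚ ↥(maximalRealSubfield L) →
      ∀ (μ : Measure (adelicGroupData (↥(maximalRealSubfield L)) L (IsCMField.complexConj L) 3 H).automorphicQuotient)
      [(adelicGroupData (↥(maximalRealSubfield L)) L (IsCMField.complexConj L) 3 H).IsAutomorphicMeasure μ]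
      (W : Type) [AddCommGroup W] [Module ℂ W]
      (σ : Representation ℂ (finAdelic (↥(maximalRealSubfield L)) L (IsCMField.complexConj L) 3 H) W),
      σ.IsIrreducible → σ.IsSmooth → σ.IsAdmissible →
      ∀ P : DiscreteAutomorphicRep (adelicGroupData (↥(maximalRealSubfield L)) L (IsCMField.complexConj L) 3 H) μ,
      ∃ ψ₀ : W →ₗ[ℂ] ((adelicGroupData (↥(maximalRealSubfield L)) L (IsCMField.complexConj L) 3 H).Adelic → (Fin 2 → ℂ)),
      ∀ ψ : W →ₗ[ℂ] ((adelicGroupData (↥(maximalRealSubfield L)) L (IsCMField.complexConj L) 3 H).Adelic → (Fin 2 → ℂ)),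
      (∀ (g : finAdelic (↥(maximalRealSubfield L)) L (IsCMField.complexConj L) 3 H) (w : W),
      ψ (σ g w) = CotangentForms.rightRep (↥(maximalRealSubfield L)) L (IsCMField.complexConj L) 3 H g (ψ w)) →
      (∀ w : W, ψ w ∈ (CotangentForms.holCotForms (↥(maximalRealSubfield L)) L (IsCMField.complexConj L) 3 H (cmArchSection L ι H T hT)
      (cmCompactFactor L ι H T hT)).map (CotangentForms.conjFun (↥(maximalRealSubfield L)) L (IsCMField.complexConj L) 3 H) ∧
      P.ContainsForm (ψ w)) →
      ∃ r : ℂ, ψ = r • ψ₀ := by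
  intro L _ _ _ ι H T hT hdef h2 μ _ W _ _ σ hirr _ hadm P
  by_cases hex : ∃ ψ₁ : W →ₗ[ℂ] ((adelicGroupData (↥(maximalRealSubfield L)) L (IsCMField.complexConj L) 3 H).Adelic → (Fin 2 → ℂ)),
      (∀ (g : finAdelic (↥(maximalRealSubfield L)) L (IsCMField.complexConj L) 3 H) (w : W), ψ₁ (σ g w) = CotangentForms.rightRep (↥(maximalRealSubfield L)) L (IsCMField.complexConj L) 3 H g (ψ₁ w)) ∧ (∀ w : W, ψ₁ w ∈ ((CotangentForms.holCotForms (↥(maximalRealSubfield L)) L (IsCMField.complexConj L) 3 H (cmArchSection L ι H T hT) (cmCompactFactor L ι H T hT)).map (CotangentForms.conjFun (↥(maximalRealSubfield L)) L (IsCMField.complexConj L) 3 H)) ∧ P.ContainsForm (ψ₁ w)) ∧ ψ₁ ≠ 0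
  · obtain ⟨ψ₁, hE₁, hV₁, hne⟩ := hex
    exact ⟨ψ₁, fun ψ hE hV => exists_eq_smul_of_orthVanish P (((CotangentForms.holCotForms (↥(maximalRealSubfield L)) L (IsCMField.complexConj L) 3 H (cmArchSection L ι H T hT) (cmCompactFactor L ι H T hT)).map (CotangentForms.conjFun (↥(maximalRealSubfield L)) L (IsCMField.complexConj L) 3 H))) (fun Φ hΦ => leftInvariant_of_mem_antihol L ι H T hT hΦ)
      (orthVanish_antihol hdef h2 μ P) σ hirr hadm ψ₁ ψ hE₁ hV₁ hne hE hV⟩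
  · refine ⟨0, fun ψ hE hV => ⟨0, ?_⟩⟩
    push Not at hex
    rw [hex ψ hE hV, smul_zero]

/-- **HEAD (E-hol, FILED letter by name):** ★ `CotangentForms.cohIsotypicLine_hol` (no admissibility binder) from ★ S1, S2⁺, S2β and S3 — the filed letter PROVED.
[cite: Liu2021, Lem. D.2 (2)] [cite: BorelWallach2000, VI 4.11; VII 3.2] -/
theorem cohIsotypicLine_hol_holds :
    Literature.NumberTheory.Automorphic.UnitaryGroup.CotangentForms.cohIsotypicLine_hol := by
  intro L _ _ _ ι H T hT hdef h2 μ _ W _ _ σ hirr hsm P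
  by_cases hex : ∃ ψ₁ : W →ₗ[ℂ] ((adelicGroupData (↥(maximalRealSubfield L)) L (IsCMField.complexConj L) 3 H).Adelic → (Fin 2 → ℂ)),
      (∀ (g : finAdelic (↥(maximalRealSubfield L)) L (IsCMField.complexConj L) 3 H) (w : W), ψ₁ (σ g w) = CotangentForms.rightRep (↥(maximalRealSubfield L)) L (IsCMField.complexConj L) 3 H g (ψ₁ w)) ∧ (∀ w : W, ψ₁ w ∈ (CotangentForms.holCotForms (↥(maximalRealSubfield L)) L (IsCMField.complexConj L) 3 H (cmArchSection L ι H T hT) (cmCompactFactor L ι H T hT)) ∧ P.ContainsForm (ψ₁ w)) ∧ ψ₁ ≠ 0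
  · obtain ⟨ψ₁, hE₁, hV₁, hne⟩ := hex
    have hadm : σ.IsAdmissible :=
      F0P2aStubAdmissibleOfCohValued.stubS3_holds L ι H T hT hdef h2 W σ hirr hsm ψ₁ hE₁ (fun w => CotangentForms.holCotForms_le_cohForms (hV₁ w).1) hne
    exact ⟨ψ₁, fun ψ hE hV => exists_eq_smul_of_orthVanish P ((CotangentForms.holCotForms (↥(maximalRealSubfield L)) L (IsCMField.complexConj L) 3 H (cmArchSection L ι H T hT) (cmCompactFactor L ι H T hT))) (fun Φ hΦ => leftInvariant_of_mem_holCotForms hΦ)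
      (orthVanish_hol hdef h2 μ P) σ hirr hadm ψ₁ ψ hE₁ hV₁ hne hE hV⟩
  · refine ⟨0, fun ψ hE hV => ⟨0, ?_⟩⟩
    push Not at hex
    rw [hex ψ hE hV, smul_zero]

/-- **HEAD (E-antihol, FILED letter by name):** ★ `CotangentForms.cohIsotypicLine_antihol` from ★ S1, S2⁻, S2β and S3 — the filed letter PROVED.
[cite: Liu2021, Lem. D.2 (2)] [cite: BorelWallach2000, VII 2.10, 3.2] -/
theorem cohIsotypicLine_antihol_holds :
    Literature.NumberTheory.Automorphic.UnitaryGroup.CotangentForms.cohIsotypicLine_antihol := by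
  intro L _ _ _ ι H T hT hdef h2 μ _ W _ _ σ hirr hsm P
  by_cases hex : ∃ ψ₁ : W →ₗ[ℂ] ((adelicGroupData (↥(maximalRealSubfield L)) L (IsCMField.complexConj L) 3 H).Adelic → (Fin 2 → ℂ)),
      (∀ (g : finAdelic (↥(maximalRealSubfield L)) L (IsCMField.complexConj L) 3 H) (w : W), ψ₁ (σ g w) = CotangentForms.rightRep (↥(maximalRealSubfield L)) L (IsCMField.complexConj L) 3 H g (ψ₁ w)) ∧ (∀ w : W, ψ₁ w ∈ ((CotangentForms.holCotForms (↥(maximalRealSubfield L)) L (IsCMField.complexConj L) 3 H (cmArchSection L ι H T hT) (cmCompactFactor L ι H T hT)).map (CotangentForms.conjFun (↥(maximalRealSubfield L)) L (IsCMField.complexConj L) 3 H)) ∧ P.ContainsForm (ψ₁ w)) ∧ ψ₁ ≠ 0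
  · obtain ⟨ψ₁, hE₁, hV₁, hne⟩ := hex
    have hadm : σ.IsAdmissible :=
      F0P2aStubAdmissibleOfCohValued.stubS3_holds L ι H T hT hdef h2 W σ hirr hsm ψ₁ hE₁ (fun w => antihol_le_coh L ι H T hT (hV₁ w).1) hne
    exact ⟨ψ₁, fun ψ hE hV => exists_eq_smul_of_orthVanish P (((CotangentForms.holCotForms (↥(maximalRealSubfield L)) L (IsCMField.complexConj L) 3 H (cmArchSection L ι H T hT) (cmCompactFactor L ι H T hT)).map (CotangentForms.conjFun (↥(maximalRealSubfield L)) L (IsCMField.complexConj L) 3 H))) (fun Φ hΦ => leftInvariant_of_mem_antihol L ι H T hT hΦ)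
      (orthVanish_antihol hdef h2 μ P) σ hirr hadm ψ₁ ψ hE₁ hV₁ hne hE hV⟩
  · refine ⟨0, fun ψ hE hV => ⟨0, ?_⟩⟩
    push Not at hex
    rw [hex ψ hE hV, smul_zero]

end Summit.HodgeConjecture.HodgeConjecture.Cruxes.H413.F0P2aCohIsotypicLineHolds

end
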